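import Summits.AtomisticToContinuum.HydrodynamicLimit.Theorems.InformationPercolationEngineCollisionRateRung0Closure
import Summits.AtomisticToContinuum.HydrodynamicLimit.Theorems.JParityClosureEvenStressEnskogPlateauWindow
import Literature.MathematicalPhysics.KineticTheory.HardSphereCanonicalTwoClusterLimit
import Literature.MathematicalPhysics.KineticTheory.HardSphereCanonicalLabelLaw
import Literature.MathematicalPhysics.KineticTheory.CollisionTubeVarianceRung0SpeedCutoffMarkWindow
import HarnessLib

/-!
# R5 · `InformationPercolationEngine.CollisionRate` AT GLOBAL EQUILIBRIUM, UNCONDITIONALLY (`collisionRateRung0`, line `Sketch`,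
# stmt-AtomisticToContinuum-13481)

The landed rung-0 closure `Theorems.CollisionRate.collisionRateConst_of_plateau`
(`…Theorems.InformationPercolationEngineCollisionRateRung0Closure`, p124661) gives the crux `CollisionRate` — the Enskog
collision-frequency law of deterministic hard spheres, i.e. `evenStat` at the constant mark — at constant profiles `(ab, ub, θb)`
modulo ONE static input, the UNWINDOWED decorrelation plateau Plateau′ (relative asymptotic independence
`|Cov| ≤ ζ vol(T) vol(T′)` of two disjoint decorated dimers under `posGibbsMeasure 1 ε_N (N+1)`, for ALL measurable `T, T′`).
The sibling crux `JParityClosure.EvenStressEnskog` (stmt-13079) has PROVED the WINDOWED plateau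
(`T, T′ ⊆ {d | d(d, 0) ≤ C ε_N}`, `N ≥ N₀(σ, C, ζ)`): `Theorems.EvenStressEnskog.plateauWindow_of_twoCluster_labelLaw` (p120767) fed by
the canonical two-cluster factorisation `Literature.….vcan_append_sub_mul_le` (p115782) and the labelled-law densities
`Literature.….integral_labelLaw_eq_integral_mul_vcan` (p119561), and re-threaded its own rung-0 closure through it
(`tubeVarianceRung0_of_plateauWindow`, `rungZero_of_plateauWindow`, `evenStressEnskog_rung0`).  The windowed plateau suffices
because the plateau enters the tube variance only through tube marks supported in the near-contact shell
`{ε_N < ‖reprSym d‖ ≤ ε_N(1 + 2Lκ)} ⊆ {d(d, 0) ≤ (1 + 2Lκ) ε_N}`, and `L, κ` are fixed before `N₀`.  This file is the same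
re-threading at the speed-truncated unit mark `Ξ₁ᴸ := fun q : V3 × V3 × V3 => speedCutoff L ‖q.2.2 − q.2.1‖`:

* `tubeVariance_unit_rung0_of_plateauWindow` — the static tube-variance input (hA) of `fixedTimeVariance_unit_rung0_of_static`
  from the WINDOWED plateau (proof of `tubeVariance_unit_rung0_of_plateau`, p123333, with the plateau instantiated at the window
  `C = 1 + 2Lκ` and the windowed mark-generic Literature bound `variance_tubeStat_rung0_le_of_speedCutoff_window`);
* `collisionRateRung0` — the registered stub: `CollisionRate` at constant profiles, unconditionally
  (`evenStatOne_rung0_of` fed by R1 `stub_unitMarkTruncationRung0`, R2 `stub_cylinderPullbackUnitRung0`,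
  R3 `stub_meanEnskogUnitRung0`, and R4's `fixedTimeVariance_unit_rung0_of_static` on the windowed tube variance and
  `enskogRateVariance_unit_rung0`, the windowed plateau discharged by `plateauWindow_of_twoCluster_labelLaw`).

References: D. Ruelle, *Statistical Mechanics: Rigorous Results* (1969) §4.2; H. Spohn, *Large Scale Dynamics of Interacting
Particles* (1991), Part I §2.3; C. Cercignani, R. Illner, M. Pulvirenti (1994) §2.2.
-/

noncomputable section

open MeasureTheory ProbabilityTheory Set Filter Topology Function
open scoped ENNReal InnerProductSpace BigOperators

namespace Summit.AtomisticToContinuum.HydrodynamicLimit.Theorems.CollisionRate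

open Literature.Analysis.FluidPDE Literature.MathematicalPhysics.KineticTheory
open Literature.MathematicalPhysics.StatisticalMechanics Literature.Probability.Moments
open Summit.AtomisticToContinuum.HydrodynamicLimit.Theorems.EvenStressEnskog

/-! ## The tube half at the unit mark `Ξ₁ᴸ` from the WINDOWED plateau -/

/-- **(hA)₀ at the unit mark from the WINDOWED plateau** (as `tubeVariance_unit_rung0_of_plateau`, whose plateau hypothesis
is unwindowed): the windowed plateau — relative asymptotic independence of two disjoint decorated dimers under the
activity-`1` canonical configurational measure for displacement sets inside the contact window `{d | d(d, 0) ≤ C ε_N}`,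
`N ≥ N₀(σ, C, ζ)`, verbatim the hypothesis of `Theorems.EvenStressEnskog.tubeVarianceRung0_of_plateauWindow` — implies the
static tube-variance input of `fixedTimeVariance_unit_rung0_of_static` at the speed-truncated unit mark `Ξ₁ᴸ` (`|Ξ₁ᴸ| ≤ 1`,
`Ξ₁ᴸ = 0` at relative speed `≥ 2L`).  The chain fixes `L, κ` before `N₀`, so the plateau is instantiated at the window
`C = 1 + 2Lκ`, which contains the near-contact shell `{ε_N < ‖reprSym d‖ ≤ ε_N (1 + 2Lκ)}` carrying the tube marks
(`variance_tubeStat_rung0_le_of_speedCutoff_window` at `C = 1`); otherwise the proof of `tubeVariance_unit_rung0_of_plateau`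
verbatim (`η₀ = 1`, `σ₀ = min σ₁ σ₂`, `r₀ = 1/4`, the four-term bound `K₁/(N+1) + K₂ ζ + K₃ ζ'² + K₄ P_N(Bad)`). [folklore] -/
theorem tubeVariance_unit_rung0_of_plateauWindow
    (hPl : ∃ σ₁ : ℝ, 0 < σ₁ ∧ ∀ σ : ℝ, 0 < σ → σ < σ₁ → ∀ C : ℝ, 1 ≤ C → ∀ ζ : ℝ, 0 < ζ → ∃ N₀ : ℕ, ∀ N : ℕ, N₀ ≤ N →
      ∀ i j k l : Fin (N + 1), i ≠ j → i ≠ k → i ≠ l → j ≠ k → j ≠ l → k ≠ l →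
      ∀ (h h' : T3 → ℝ), Measurable h → Measurable h' → (∀ y, |h y| ≤ 1) → (∀ y, |h' y| ≤ 1) →
      ∀ T T' : Set T3, MeasurableSet T → MeasurableSet T' →
      T ⊆ {d | Torus.euclidDist d 0 ≤ C * hsDiameter σ N} → T' ⊆ {d | Torus.euclidDist d 0 ≤ C * hsDiameter σ N} →
      |(∫ x, h (x i) * T.indicator (fun _ => (1 : ℝ)) (x j - x i) * (h' (x k) * T'.indicator (fun _ => (1 : ℝ)) (x l - x k))
          ∂posGibbsMeasure (fun _ : T3 => (1 : ℝ)) (hsDiameter σ N) (N + 1)) -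
        (∫ x, h (x i) * T.indicator (fun _ => (1 : ℝ)) (x j - x i)
          ∂posGibbsMeasure (fun _ : T3 => (1 : ℝ)) (hsDiameter σ N) (N + 1)) *
        (∫ x, h' (x k) * T'.indicator (fun _ => (1 : ℝ)) (x l - x k)
          ∂posGibbsMeasure (fun _ : T3 => (1 : ℝ)) (hsDiameter σ N) (N + 1))|
        ≤ ζ * (volume T).toReal * (volume T').toReal) :
    ∃ η₀ : ℝ, 0 < η₀ ∧ ∀ (a θ : ℝ) (u : V3), 0 < a → 0 < θ → ∃ σ₀ : ℝ, 0 < σ₀ ∧ ∀ σ : ℝ, 0 < σ → σ < σ₀ →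
      ∀ Φ : (N : ℕ) → HardSphereFlow (Torus.geometry (Fin 3)) (hsDiameter σ N) (N + 1), ∀ τ : ℝ, 0 < τ →
      ∀ χ : ℝ × UnitAddTorus (Fin 3) → ℝ, Continuous χ → ∀ g : ℝ → ℝ, Continuous g →
      (∀ a', η₀ ≤ a' → g a' = 0) → ∀ ς : ℝ, 0 < ς → ∃ r₀ : ℝ, 0 < r₀ ∧ ∀ r : ℝ, 0 < r → r < r₀ →
      ∀ L κ : ℝ, 1 ≤ L → 0 < κ → κ ≤ 1 → ∃ N₀ : ℕ, ∀ N : ℕ, N₀ ≤ N → ∀ t ∈ Set.Icc (0 : ℝ) τ,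
        ProbabilityTheory.variance
          (fun z => tubeStat σ N χ g (fun q : V3 × V3 × V3 => speedCutoff L ‖q.2.2 - q.2.1‖) r r 1 κ t z)
          (localGibbsLaw σ (fun _ => a) (fun _ => u) (fun _ => θ) N (Φ N)) ≤ ς := by
  -- adapted from `tubeVariance_unit_rung0_of_plateau` (Theorems/…CollisionRateFixedTimeVarianceUnitRung0, p123333) and
  -- `Theorems.EvenStressEnskog.tubeVarianceRung0_of_plateauWindow` (p121189)
  obtain ⟨σ₁, hσ₁, hPl⟩ := hPl
  refine ⟨1, one_pos, ?_⟩
  intro a θ u ha hθ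
  obtain ⟨σ₂, hσ₂, hsmall⟩ := exists_smallDensity uniformProfile one_pos
  refine ⟨min σ₁ σ₂, lt_min hσ₁ hσ₂, ?_⟩
  intro σ hσ hσlt Φ τ hτ χ hχ g hg hg0 ς hς
  have hsd : SmallDensity uniformProfile σ := (hsmall σ hσ (lt_of_lt_of_le hσlt (min_le_right _ _))).1
  have hσ1 : σ < σ₁ := lt_of_lt_of_le hσlt (min_le_left _ _)
  refine ⟨1 / 4, by norm_num, ?_⟩
  intro r hr hr4 L κ hL hκ hκ1
  have hL0 : 0 < L := one_pos.trans_le hL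
  have hr2 : r < 1 / 2 := hr4.trans (by norm_num)
  -- the mark `Ξ₁ᴸ`: measurable, bounded by `1`, vanishing at relative speed `≥ 2L`
  have hΞm : Measurable fun q : V3 × V3 × V3 => speedCutoff L ‖q.2.2 - q.2.1‖ :=
    (continuous_speedCutoff_mark L).measurable
  have hC : ∀ q : V3 × V3 × V3, |speedCutoff L ‖q.2.2 - q.2.1‖| ≤ 1 := fun q => abs_speedCutoff_le_one L _
  have hΞL : ∀ m v v' : V3, 2 * L ≤ ‖v - v'‖ →
      (fun q : V3 × V3 × V3 => speedCutoff L ‖q.2.2 - q.2.1‖) (m, v, v') = 0 := fun m v v' hvv' => by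
    show speedCutoff L ‖v' - v‖ = 0
    rw [norm_sub_rev]
    exact speedCutoff_eq_zero hL0 hvv'
  -- the constants
  obtain ⟨Cχ, hCχ, hχb⟩ := exists_pos_bound_on_strip hχ τ
  obtain ⟨Cg, hCg⟩ := exists_bound_of_vanishing hg hg0
  set Cp : ℝ := (3 + 4 * L * κ) ^ 3 with hCp
  set VL : ℝ := 4 / 3 * Real.pi * (1 + 2 * L * κ) ^ 3 with hVL
  set K₁ : ℝ := 2 * (Cg * Cχ / κ) ^ 2 * (16 * Cp ^ 2 + 32 * VL * σ ^ 3 + 192 * VL ^ 2 * σ ^ 6) with hK₁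
  set K₂ : ℝ := 2 * (Cg * Cχ / κ) ^ 2 * (8 * VL ^ 2 * σ ^ 6) with hK₂
  set K₃ : ℝ := 2 * (Cχ * Cp / κ) ^ 2 * 2 with hK₃
  set K₄ : ℝ := 2 * (Cχ * Cp / κ) ^ 2 * (8 * Cg ^ 2) with hK₄
  have hVL0 : 0 ≤ VL := by rw [hVL]; positivity
  have hK₁0 : 0 ≤ K₁ := by rw [hK₁]; positivity
  have hK₂0 : 0 ≤ K₂ := by rw [hK₂]; positivity
  have hK₃0 : 0 ≤ K₃ := by rw [hK₃]; positivity
  have hK₄0 : 0 ≤ K₄ := by rw [hK₄]; positivity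
  have hς4 : 0 < ς / 4 := by positivity
  -- the small parameters
  obtain ⟨ζ, hζ, -, hζK⟩ := exists_pos_mul_le hK₂0 hς4
  obtain ⟨ζ', hζ', hζ'1, hζ'K⟩ := exists_pos_mul_le hK₃0 hς4
  obtain ⟨δ, hδ, hmod⟩ := exists_modulus_at_cube hg hσ hζ'
  obtain ⟨η₄, hη₄, -, hη₄K⟩ := exists_pos_mul_le hK₄0 hς4
  -- the thresholds in `N`; the plateau at the window `C = 1 + 2Lκ`
  obtain ⟨N₂, hN₂⟩ := exists_hsDiameter_mul_lt σ (1 + 2 * L * κ)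
  have hC1 : (1 : ℝ) ≤ 1 + 2 * L * κ := by nlinarith
  obtain ⟨N₃, hN₃⟩ := hPl σ hσ hσ1 (1 + 2 * L * κ) hC1 ζ hζ
  obtain ⟨N₄, hN₄⟩ := exists_posGibbs_sqDevEvent_le hsd one_pos hr hr2 hδ hη₄
  obtain ⟨N₅, hN₅⟩ := exists_nat_div_succ_le K₁ hς4
  refine ⟨max (max (max 1 N₂) (max N₃ N₄)) N₅, fun N hN t ht => ?_⟩
  have hN1 : 1 ≤ N := le_trans (le_trans (le_trans (le_max_left _ _) (le_max_left _ _)) (le_max_left _ _)) hN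
  have hN2' : N₂ ≤ N := le_trans (le_trans (le_trans (le_max_right _ _) (le_max_left _ _)) (le_max_left _ _)) hN
  have hN3' : N₃ ≤ N := le_trans (le_trans (le_trans (le_max_left _ _) (le_max_right _ _)) (le_max_left _ _)) hN
  have hN4' : N₄ ≤ N := le_trans (le_trans (le_trans (le_max_right _ _) (le_max_right _ _)) (le_max_left _ _)) hN
  have hN5' : N₅ ≤ N := le_trans (le_max_right _ _) hN
  -- the weight `h = χ(t, ·)/C_χ` fed to the plateau
  have hhm : Measurable fun y : T3 => χ (t, y) / Cχ := (hχ.comp (Continuous.prodMk_right t)).measurable.div_const _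
  have hh1 : ∀ y : T3, |χ (t, y) / Cχ| ≤ 1 := fun y => by
    rw [abs_div, abs_of_pos hCχ, div_le_one hCχ]; exact hχb t ht y
  -- the near-contact shell lies in the contact window of radius `(1 + 2Lκ) ε_N`
  have hDW : {d : T3 | hsDiameter σ N < ‖Torus.reprSym d‖ ∧ ‖Torus.reprSym d‖ ≤ hsDiameter σ N * (1 + 2 * L * κ)} ⊆
      {d : T3 | Torus.euclidDist d 0 ≤ (1 + 2 * L * κ) * hsDiameter σ N} := fun d hd => by
    rw [mem_setOf_eq, Torus.euclidDist, sub_zero, mul_comm]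
    exact hd.2
  have hdec := fun (i j i' j' : Fin (N + 1)) (hij : i ≠ j) (hii' : i ≠ i') (hij' : i ≠ j') (hji' : j ≠ i')
    (hjj' : j ≠ j') (hi'j' : i' ≠ j') (T T' : Set T3) (hT : MeasurableSet T) (hT' : MeasurableSet T')
    (hTD : T ⊆ {d : T3 | hsDiameter σ N < ‖Torus.reprSym d‖ ∧ ‖Torus.reprSym d‖ ≤ hsDiameter σ N * (1 + 2 * L * κ)})
    (hT'D : T' ⊆ {d : T3 | hsDiameter σ N < ‖Torus.reprSym d‖ ∧ ‖Torus.reprSym d‖ ≤ hsDiameter σ N * (1 + 2 * L * κ)}) =>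
    hN₃ N hN3' i j i' j' hij hii' hij' hji' hjj' hi'j' (fun y => χ (t, y) / Cχ) (fun y => χ (t, y) / Cχ) hhm hhm hh1 hh1
      T T' hT hT' (hTD.trans hDW) (hT'D.trans hDW)
  -- the generic windowed bound at `C = 1`
  have hmain := variance_tubeStat_rung0_le_of_speedCutoff_window hsd ha hθ u hN1 (Φ N) hχ hCχ t (hχb t ht) hg hCg hΞm
    one_pos hC hL0.le hΞL hκ hr (hN₂ N hN2') hζ.le hdec hζ'.le hδ hmod
  -- the four terms
  have h1 : K₁ / ((N + 1 : ℕ) : ℝ) ≤ ς / 4 := hN₅ N hN5'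
  have h2 : K₂ * ζ ≤ ς / 4 := hζK
  have h3 : K₃ * ζ' ^ 2 ≤ ς / 4 := by
    have hsq : ζ' ^ 2 ≤ ζ' := by
      calc ζ' ^ 2 = ζ' * ζ' := sq ζ'
        _ ≤ ζ' * 1 := mul_le_mul_of_nonneg_left hζ'1 hζ'.le
        _ = ζ' := mul_one ζ'
    exact (mul_le_mul_of_nonneg_left hsq hK₃0).trans hζ'K
  have h4 : K₄ * (posGibbsMeasure (fun _ : T3 => (1 : ℝ)) (hsDiameter σ N) (N + 1)).real (sqDevEvent (N + 1) δ r) ≤ ς / 4 :=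
    (mul_le_mul_of_nonneg_left (hN₄ N hN4') hK₄0).trans hη₄K
  have hsum : 2 * (Cg * Cχ / κ) ^ 2 *
        ((16 * (1 : ℝ) ^ 2 * ((3 + 4 * L * κ) ^ 3) ^ 2 + 32 * (1 : ℝ) ^ 2 * (4 / 3 * Real.pi * (1 + 2 * L * κ) ^ 3) * σ ^ 3 +
            192 * (1 : ℝ) ^ 2 * (4 / 3 * Real.pi * (1 + 2 * L * κ) ^ 3) ^ 2 * σ ^ 6) / (N + 1 : ℕ) +
          8 * ζ * (1 : ℝ) ^ 2 * (4 / 3 * Real.pi * (1 + 2 * L * κ) ^ 3) ^ 2 * σ ^ 6) +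
        2 * (1 * Cχ * (3 + 4 * L * κ) ^ 3 / κ) ^ 2 * (2 * ζ' ^ 2 + 8 * Cg ^ 2 *
          (posGibbsMeasure (fun _ : T3 => (1 : ℝ)) (hsDiameter σ N) (N + 1)).real (sqDevEvent (N + 1) δ r)) =
      K₁ / ((N + 1 : ℕ) : ℝ) + K₂ * ζ + K₃ * ζ' ^ 2 +
        K₄ * (posGibbsMeasure (fun _ : T3 => (1 : ℝ)) (hsDiameter σ N) (N + 1)).real (sqDevEvent (N + 1) δ r) := by
    rw [hK₁, hK₂, hK₃, hK₄, hCp, hVL]; ring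
  rw [hsum] at hmain
  linarith only [hmain, h1, h2, h3, h4]

/-! ## The registered stub -/

/-- **R5 · `CollisionRate` AT GLOBAL EQUILIBRIUM, UNCONDITIONALLY** (registered rung-0 stub `collisionRateRung0` of the line
`Sketch`, crux `InformationPercolationEngine.CollisionRate`, stmt-AtomisticToContinuum-13481, verbatim).  For constant
profiles `(ab, ub, θb)` the crux in its `evenStat`-at-the-unit-mark frame (`collisionRate_iff_evenStat_one`): for a universal
`η₀ > 0`, `σ < σ₀`, every hard-sphere flow family, horizon `τ`, localiser `χ`, cutoff `g` vanishing on `[η₀, ∞)` and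
`η, δ > 0`, eventually in `r → 0` then `N → ∞`, `G_N(η < |K_N[χ g(σ³ρ_r)] − σ³∫∫ χ g Y(σ³ρ_r) B¹_r|) ≤ δ` under the
(flow-invariant) canonical law — the Enskog collision-frequency law of the canonical hard-sphere gas on `𝕋³` at small reduced
density, now a THEOREM: the composition `evenStatOne_rung0_of` (p124661) fed by the landed unit-mark stubs R1
`stub_unitMarkTruncationRung0` (p112143), R2 `stub_cylinderPullbackUnitRung0` (p118935), R3 `stub_meanEnskogUnitRung0` (p121619)
and R4's static assembly `fixedTimeVariance_unit_rung0_of_static` (p123333) on the WINDOWED tube variance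
`tubeVariance_unit_rung0_of_plateauWindow` and `enskogRateVariance_unit_rung0`, the windowed plateau being the sibling's theorem
`Theorems.EvenStressEnskog.plateauWindow_of_twoCluster_labelLaw` (p120767) applied to the Literature statics
`vcan_append_sub_mul_le` (canonical two-cluster factorisation, p115782) and `integral_labelLaw_eq_integral_mul_vcan`
(labelled-law densities, p119561). [folklore] -/
theorem collisionRateRung0 :
    ∃ η₀ : ℝ, 0 < η₀ ∧ ∀ (ab θb : ℝ) (ub : V3), 0 < ab → 0 < θb → ∃ σ₀ : ℝ, 0 < σ₀ ∧ ∀ σ : ℝ, 0 < σ → σ < σ₀ →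
      ∀ Φ : (N : ℕ) → HardSphereFlow (Torus.geometry (Fin 3)) (hsDiameter σ N) (N + 1),
      ∀ τ : ℝ, 0 < τ → ∀ χ : ℝ × T3 → ℝ, Continuous χ → ∀ g : ℝ → ℝ, Continuous g →
      (∀ x, η₀ ≤ x → g x = 0) →
      ∀ η δ : ℝ, 0 < η → 0 < δ → ∃ r₀ : ℝ, 0 < r₀ ∧ ∀ r : ℝ, 0 < r → r < r₀ →
      ∃ N₀ : ℕ, ∀ N : ℕ, N₀ ≤ N →
        localGibbsLaw σ (fun _ => ab) (fun _ => ub) (fun _ => θb) N (Φ N) {z | η < |evenStat σ N (Φ N) τ χ g (fun _ => 1) r z|}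
          ≤ ENNReal.ofReal δ :=
  evenStatOne_rung0_of Summit.AtomisticToContinuum.HydrodynamicLimit.Theorems.CollisionRate.stub_unitMarkTruncationRung0
    Summit.AtomisticToContinuum.HydrodynamicLimit.Theorems.CollisionRate.stub_cylinderPullbackUnitRung0
    Summit.AtomisticToContinuum.HydrodynamicLimit.Theorems.CollisionRate.stub_meanEnskogUnitRung0
    (fixedTimeVariance_unit_rung0_of_static
      (tubeVariance_unit_rung0_of_plateauWindow
        (Summit.AtomisticToContinuum.HydrodynamicLimit.Theorems.EvenStressEnskog.plateauWindow_of_twoCluster_labelLaw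
          Literature.MathematicalPhysics.KineticTheory.vcan_append_sub_mul_le
          Literature.MathematicalPhysics.KineticTheory.integral_labelLaw_eq_integral_mul_vcan))
      enskogRateVariance_unit_rung0)

end Summit.AtomisticToContinuum.HydrodynamicLimit.Theorems.CollisionRate

end
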